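import Summits.AtomisticToContinuum.Crystallization.Theorems.ChessboardParticlePlanesPeriodicWindowsHcRot3

/-!
# Crux `PeriodicWindows` (stmt-AtomisticToContinuum-3240), line `dense-laminar-hull` — the first three moments of
# the `2π/3`-symmetrisation for an abstract admissible rotation (stub `hc_rot3_cubic` of the hollow closing, lead c12)

An additive `ℝ`-homogeneous `T : ℝ³ →+ ℝ³` with `T v₁(a) = v₂(a) - v₁(a)`, `T v₂(a) = -v₁(a)` and `T e₃ = e₃`
(`a > 0`) is the rotation by `2π/3` about `e₃`: `v₁(a), v₂(a), e₃` is a basis of `ℝ³`, so `T` has the coordinates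
`T w = (-w₀/2 - (√3/2) w₁, (√3/2) w₀ - w₁/2, w₂)` (`hcc_T_apply`, via the decomposition `hcc_smul_decomp` of `a w`
in this basis). For horizontal `u, ξ` and `tₖ := ‖u + Tᵏ ξ‖² - ‖u‖² - ‖ξ‖² = 2 ⟪u, Tᵏ ξ⟫` (`k = 0, 1, 2`) we
prove `∑ₖ tₖ = 0`, `∑ₖ tₖ² = 6 ‖u‖² ‖ξ‖²` and `|∑ₖ tₖ³| ≤ 6 ‖u‖³ ‖ξ‖³` (`hc_rot3_cubic`): with
`p = u₀ ξ₀ + u₁ ξ₁` and `q = u₀ ξ₁ - u₁ ξ₀` one has `t₀ = 2p`, `t₁ = -p - √3 q`, `t₂ = -p + √3 q`, whence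
`∑ₖ tₖ³ = 6 (p³ - 3 p q²) = 6 Re (p + i q)³` (`hcc_cubic_bound`), and `(p³ - 3 p q²)² ≤ (p² + q²)³`
(`hcc_re_cube_sq_le`, i.e. `(Re z³)² ≤ |z|⁶`) with `p² + q² = ‖u‖² ‖ξ‖²` (Lagrange's identity). [folklore]
-/

noncomputable section

namespace Summit.AtomisticToContinuum.Crystallization.Theorems.PeriodicWindowsDenseLaminarHull

open Literature.MathematicalPhysics.StatisticalMechanics Filter Metric
open scoped BigOperators

/-- **Coordinates of `a • w` in the basis `v₁(a), v₂(a), e₃`**: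
`a w = (w₀ - (√3/3) w₁) v₁(a) + (2√3/3) w₁ v₂(a) + a w₂ e₃` (using `(√3)² = 3`). [folklore] -/
theorem hcc_smul_decomp (a : ℝ) (w : EuclideanSpace ℝ (Fin 3)) :
    a • w = (w 0 - √3 * w 1 / 3) • triangularVec₁ a + (2 * √3 * w 1 / 3) • triangularVec₂ a +
      (a * w 2) • layerNormal 1 := by
  have h3 : (√3 : ℝ) ^ 2 = 3 := Real.sq_sqrt (by norm_num)
  obtain ⟨h10, h11, h12⟩ : (triangularVec₁ a) 0 = a ∧ (triangularVec₁ a) 1 = 0 ∧ (triangularVec₁ a) 2 = 0 := by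
    simp [triangularVec₁]
  obtain ⟨h20, h21, h22⟩ :
      (triangularVec₂ a) 0 = a / 2 ∧ (triangularVec₂ a) 1 = a * √3 / 2 ∧ (triangularVec₂ a) 2 = 0 := by
    simp [triangularVec₂]
  obtain ⟨he0, he1, he2⟩ : (layerNormal 1 : EuclideanSpace ℝ (Fin 3)) 0 = 0 ∧
      (layerNormal 1 : EuclideanSpace ℝ (Fin 3)) 1 = 0 ∧ (layerNormal 1 : EuclideanSpace ℝ (Fin 3)) 2 = 1 := by
    simp [layerNormal]
  have e0 : (a • w) 0 = ((w 0 - √3 * w 1 / 3) • triangularVec₁ a + (2 * √3 * w 1 / 3) • triangularVec₂ a +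
      (a * w 2) • layerNormal 1) 0 := by
    simp only [PiLp.add_apply, PiLp.smul_apply, smul_eq_mul]
    rw [h10, h20, he0]
    ring
  have e1 : (a • w) 1 = ((w 0 - √3 * w 1 / 3) • triangularVec₁ a + (2 * √3 * w 1 / 3) • triangularVec₂ a +
      (a * w 2) • layerNormal 1) 1 := by
    simp only [PiLp.add_apply, PiLp.smul_apply, smul_eq_mul]
    rw [h11, h21, he1]
    linear_combination (-(a * w 1 / 3)) * h3
  have e2 : (a • w) 2 = ((w 0 - √3 * w 1 / 3) • triangularVec₁ a + (2 * √3 * w 1 / 3) • triangularVec₂ a +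
      (a * w 2) • layerNormal 1) 2 := by
    simp only [PiLp.add_apply, PiLp.smul_apply, smul_eq_mul]
    rw [h12, h22, he2]
    ring
  ext i
  fin_cases i
  exacts [e0, e1, e2]

/-- **An admissible rotation in coordinates**: an additive `ℝ`-homogeneous `T` with `T v₁(a) = v₂(a) - v₁(a)`,
`T v₂(a) = -v₁(a)` and `T e₃ = e₃` (`a > 0`) is `T w = (-w₀/2 - (√3/2) w₁, (√3/2) w₀ - w₁/2, w₂)`: apply `T` to
the decomposition `hcc_smul_decomp` of `a w` and cancel `a`. [folklore] -/
theorem hcc_T_apply {a : ℝ} (ha : 0 < a) (T : EuclideanSpace ℝ (Fin 3) →+ EuclideanSpace ℝ (Fin 3))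
    (hv₁ : T (triangularVec₁ a) = triangularVec₂ a - triangularVec₁ a)
    (hv₂ : T (triangularVec₂ a) = -triangularVec₁ a) (he : T (layerNormal 1) = layerNormal 1)
    (hhom : ∀ (c : ℝ) (w : EuclideanSpace ℝ (Fin 3)), T (c • w) = c • T w) (w : EuclideanSpace ℝ (Fin 3)) :
    T w 0 = -(1 / 2) * w 0 - √3 / 2 * w 1 ∧ T w 1 = √3 / 2 * w 0 - (1 / 2) * w 1 ∧ T w 2 = w 2 := by
  have h3 : (√3 : ℝ) ^ 2 = 3 := Real.sq_sqrt (by norm_num)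
  have ha0 : a ≠ 0 := ha.ne'
  obtain ⟨h10, h11, h12⟩ : (triangularVec₁ a) 0 = a ∧ (triangularVec₁ a) 1 = 0 ∧ (triangularVec₁ a) 2 = 0 := by
    simp [triangularVec₁]
  obtain ⟨h20, h21, h22⟩ :
      (triangularVec₂ a) 0 = a / 2 ∧ (triangularVec₂ a) 1 = a * √3 / 2 ∧ (triangularVec₂ a) 2 = 0 := by
    simp [triangularVec₂]
  obtain ⟨he0, he1, he2⟩ : (layerNormal 1 : EuclideanSpace ℝ (Fin 3)) 0 = 0 ∧
      (layerNormal 1 : EuclideanSpace ℝ (Fin 3)) 1 = 0 ∧ (layerNormal 1 : EuclideanSpace ℝ (Fin 3)) 2 = 1 := by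
    simp [layerNormal]
  -- `a • T w = T (a • w)`, expanded in the basis
  have hX : a • T w = (w 0 - √3 * w 1 / 3) • (triangularVec₂ a - triangularVec₁ a) +
      (2 * √3 * w 1 / 3) • (-triangularVec₁ a) + (a * w 2) • layerNormal 1 := by
    rw [← hhom, hcc_smul_decomp a w, map_add, map_add, hhom, hhom, hhom, hv₁, hv₂, he]
  have c0 : (a • T w) 0 = ((w 0 - √3 * w 1 / 3) • (triangularVec₂ a - triangularVec₁ a) +
      (2 * √3 * w 1 / 3) • (-triangularVec₁ a) + (a * w 2) • layerNormal 1) 0 := by rw [hX]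
  have c1 : (a • T w) 1 = ((w 0 - √3 * w 1 / 3) • (triangularVec₂ a - triangularVec₁ a) +
      (2 * √3 * w 1 / 3) • (-triangularVec₁ a) + (a * w 2) • layerNormal 1) 1 := by rw [hX]
  have c2 : (a • T w) 2 = ((w 0 - √3 * w 1 / 3) • (triangularVec₂ a - triangularVec₁ a) +
      (2 * √3 * w 1 / 3) • (-triangularVec₁ a) + (a * w 2) • layerNormal 1) 2 := by rw [hX]
  simp only [PiLp.add_apply, PiLp.sub_apply, PiLp.neg_apply, PiLp.smul_apply, smul_eq_mul] at c0 c1 c2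
  rw [h10, h20, he0] at c0
  rw [h11, h21, he1] at c1
  rw [h12, h22, he2] at c2
  refine ⟨mul_left_cancel₀ ha0 ?_, mul_left_cancel₀ ha0 ?_, mul_left_cancel₀ ha0 ?_⟩
  · linear_combination c0
  · linear_combination c1 - (a * w 1 / 6) * h3
  · linear_combination c2

/-- `(Re z³)² ≤ |z|⁶` for `z = p + i q`: `(p³ - 3 p q²)² ≤ (p² + q²)³`, the defect being `(3 p² q - q³)²`.
[folklore] -/
theorem hcc_re_cube_sq_le (p q : ℝ) : (p ^ 3 - 3 * p * q ^ 2) ^ 2 ≤ (p ^ 2 + q ^ 2) ^ 3 := by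
  nlinarith [sq_nonneg (3 * p ^ 2 * q - q ^ 3)]

/-- **The cubic moment in coordinates**: with `t₀ = 2 (u₀ x₀ + u₁ x₁)`, `t₁`, `t₂` the brackets `2 ⟪u, Tᵏ x⟫`
written out in the coordinates of the `2π/3`-rotation `T`, and `N ≥ 0` with `N² = (u₀² + u₁²) (x₀² + x₁²)`:
`t₀³ + t₁³ + t₂³ = 6 (p³ - 3 p q²)` (`p = u₀ x₀ + u₁ x₁`, `q = u₀ x₁ - u₁ x₀`, `p² + q² = N²`), hence
`|t₀³ + t₁³ + t₂³| ≤ 6 N³`. [folklore] -/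
theorem hcc_cubic_bound (u₀ u₁ x₀ x₁ N : ℝ) (hN : 0 ≤ N)
    (hN2 : N ^ 2 = (u₀ ^ 2 + u₁ ^ 2) * (x₀ ^ 2 + x₁ ^ 2)) :
    |(2 * (u₀ * x₀ + u₁ * x₁)) ^ 3 +
        (2 * (u₀ * (-(1 / 2) * x₀ - √3 / 2 * x₁) + u₁ * (√3 / 2 * x₀ - (1 / 2) * x₁))) ^ 3 +
        (2 * (u₀ * (-(1 / 2) * x₀ + √3 / 2 * x₁) + u₁ * (-(√3 / 2) * x₀ - (1 / 2) * x₁))) ^ 3| ≤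
      6 * N ^ 3 := by
  have h3 : (√3 : ℝ) ^ 2 = 3 := Real.sq_sqrt (by norm_num)
  have hS : (2 * (u₀ * x₀ + u₁ * x₁)) ^ 3 +
        (2 * (u₀ * (-(1 / 2) * x₀ - √3 / 2 * x₁) + u₁ * (√3 / 2 * x₀ - (1 / 2) * x₁))) ^ 3 +
        (2 * (u₀ * (-(1 / 2) * x₀ + √3 / 2 * x₁) + u₁ * (-(√3 / 2) * x₀ - (1 / 2) * x₁))) ^ 3 =
      6 * ((u₀ * x₀ + u₁ * x₁) ^ 3 - 3 * (u₀ * x₀ + u₁ * x₁) * (u₀ * x₁ - u₁ * x₀) ^ 2) := by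
    linear_combination (-6 * (u₀ * x₀ + u₁ * x₁) * (u₀ * x₁ - u₁ * x₀) ^ 2) * h3
  have hle : |(u₀ * x₀ + u₁ * x₁) ^ 3 - 3 * (u₀ * x₀ + u₁ * x₁) * (u₀ * x₁ - u₁ * x₀) ^ 2| ≤ N ^ 3 := by
    refine abs_le_of_sq_le_sq ?_ (pow_nonneg hN 3)
    calc ((u₀ * x₀ + u₁ * x₁) ^ 3 - 3 * (u₀ * x₀ + u₁ * x₁) * (u₀ * x₁ - u₁ * x₀) ^ 2) ^ 2
        ≤ ((u₀ * x₀ + u₁ * x₁) ^ 2 + (u₀ * x₁ - u₁ * x₀) ^ 2) ^ 3 := hcc_re_cube_sq_le _ _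
      _ = (N ^ 2) ^ 3 := by rw [hN2]; ring
      _ = (N ^ 3) ^ 2 := by ring
  rw [hS, abs_mul, abs_of_pos (by norm_num : (0 : ℝ) < 6)]
  linarith

/-- **The first three moments of the `2π/3`-symmetrisation** (stub `hc_rot3_cubic` of the hollow closing): for an
abstract admissible rotation `T` (additive, norm-preserving, `ℝ`-homogeneous, `T v₁(a) = v₂(a) - v₁(a)`,
`T v₂(a) = -v₁(a)`, `T e₃ = e₃`, `a > 0`) and horizontal `u, ξ`, the brackets `tₖ := ‖u + Tᵏ ξ‖² - ‖u‖² - ‖ξ‖²`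
(`k = 0, 1, 2`) satisfy `∑ₖ tₖ = 0`, `∑ₖ tₖ² = 6 ‖u‖² ‖ξ‖²` and `|∑ₖ tₖ³| ≤ 6 ‖u‖³ ‖ξ‖³`. [folklore] -/
theorem hc_rot3_cubic : ∀ (a : ℝ), 0 < a → ∀ (T : EuclideanSpace ℝ (Fin 3) →+ EuclideanSpace ℝ (Fin 3)), (∀ w, ‖T w‖ = ‖w‖) →
    T (triangularVec₁ a) = triangularVec₂ a - triangularVec₁ a → T (triangularVec₂ a) = -triangularVec₁ a →
    T (layerNormal 1) = layerNormal 1 → (∀ (c : ℝ) (w : EuclideanSpace ℝ (Fin 3)), T (c • w) = c • T w) →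
    ∀ u ξ : EuclideanSpace ℝ (Fin 3), u 2 = 0 → ξ 2 = 0 →
      (‖u + ξ‖ ^ 2 - ‖u‖ ^ 2 - ‖ξ‖ ^ 2) + (‖u + T ξ‖ ^ 2 - ‖u‖ ^ 2 - ‖ξ‖ ^ 2) +
        (‖u + T (T ξ)‖ ^ 2 - ‖u‖ ^ 2 - ‖ξ‖ ^ 2) = 0 ∧
      (‖u + ξ‖ ^ 2 - ‖u‖ ^ 2 - ‖ξ‖ ^ 2) ^ 2 + (‖u + T ξ‖ ^ 2 - ‖u‖ ^ 2 - ‖ξ‖ ^ 2) ^ 2 +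
        (‖u + T (T ξ)‖ ^ 2 - ‖u‖ ^ 2 - ‖ξ‖ ^ 2) ^ 2 = 6 * ‖u‖ ^ 2 * ‖ξ‖ ^ 2 ∧
      |(‖u + ξ‖ ^ 2 - ‖u‖ ^ 2 - ‖ξ‖ ^ 2) ^ 3 + (‖u + T ξ‖ ^ 2 - ‖u‖ ^ 2 - ‖ξ‖ ^ 2) ^ 3 +
        (‖u + T (T ξ)‖ ^ 2 - ‖u‖ ^ 2 - ‖ξ‖ ^ 2) ^ 3| ≤ 6 * ‖u‖ ^ 3 * ‖ξ‖ ^ 3 := by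
  intro a ha T hTn hv₁ hv₂ he hhom u ξ hu hξ
  have h3 : (√3 : ℝ) ^ 2 = 3 := Real.sq_sqrt (by norm_num)
  -- the coordinates of `T` and of `T ∘ T` (the rotation by `4π/3`)
  have hT0 : ∀ w : EuclideanSpace ℝ (Fin 3), T w 0 = -(1 / 2) * w 0 - √3 / 2 * w 1 := fun w =>
    (hcc_T_apply ha T hv₁ hv₂ he hhom w).1
  have hT1 : ∀ w : EuclideanSpace ℝ (Fin 3), T w 1 = √3 / 2 * w 0 - (1 / 2) * w 1 := fun w =>
    (hcc_T_apply ha T hv₁ hv₂ he hhom w).2.1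
  have hT2 : ∀ w : EuclideanSpace ℝ (Fin 3), T w 2 = w 2 := fun w => (hcc_T_apply ha T hv₁ hv₂ he hhom w).2.2
  have hTT0 : T (T ξ) 0 = -(1 / 2) * ξ 0 + √3 / 2 * ξ 1 := by
    rw [hT0 (T ξ), hT0 ξ, hT1 ξ]
    linear_combination (-(ξ 0) / 4) * h3
  have hTT1 : T (T ξ) 1 = -(√3 / 2) * ξ 0 - (1 / 2) * ξ 1 := by
    rw [hT1 (T ξ), hT0 ξ, hT1 ξ]
    linear_combination (-(ξ 1) / 4) * h3
  have hTξ : (T ξ) 2 = 0 := by rw [hT2, hξ]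
  have hTTξ : (T (T ξ)) 2 = 0 := by rw [hT2, hTξ]
  -- `‖u + η‖² - ‖u‖² - ‖η‖² = 2 ⟪u, η⟫` for horizontal `η`
  have hbr : ∀ η : EuclideanSpace ℝ (Fin 3), η 2 = 0 →
      ‖u + η‖ ^ 2 - ‖u‖ ^ 2 - ‖η‖ ^ 2 = 2 * (u 0 * η 0 + u 1 * η 1) := fun η hη => by
    rw [gsc_norm_sq_eq (u + η), gsc_norm_sq_eq u, gsc_norm_sq_eq η, PiLp.add_apply, PiLp.add_apply,
      PiLp.add_apply, hu, hη]
    ring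
  have h0 := hbr ξ hξ
  have h1 : ‖u + T ξ‖ ^ 2 - ‖u‖ ^ 2 - ‖ξ‖ ^ 2 =
      2 * (u 0 * (-(1 / 2) * ξ 0 - √3 / 2 * ξ 1) + u 1 * (√3 / 2 * ξ 0 - (1 / 2) * ξ 1)) := by
    rw [← hTn ξ, hbr (T ξ) hTξ, hT0, hT1]
  have h2 : ‖u + T (T ξ)‖ ^ 2 - ‖u‖ ^ 2 - ‖ξ‖ ^ 2 =
      2 * (u 0 * (-(1 / 2) * ξ 0 + √3 / 2 * ξ 1) + u 1 * (-(√3 / 2) * ξ 0 - (1 / 2) * ξ 1)) := by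
    rw [← hTn ξ, ← hTn (T ξ), hbr (T (T ξ)) hTTξ, hTT0, hTT1]
  have hu2 : ‖u‖ ^ 2 = u 0 ^ 2 + u 1 ^ 2 := by
    rw [gsc_norm_sq_eq u, hu]
    ring
  have hξ2 : ‖ξ‖ ^ 2 = ξ 0 ^ 2 + ξ 1 ^ 2 := by
    rw [gsc_norm_sq_eq ξ, hξ]
    ring
  refine ⟨?_, ?_, ?_⟩
  · -- first moment: `1 + ω + ω² = 0`
    rw [h0, h1, h2]
    ring
  · -- second moment
    rw [h0, h1, h2, hu2, hξ2]
    linear_combination (2 * (u 0 * ξ 1 - u 1 * ξ 0) ^ 2) * h3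
  · -- third moment
    rw [h0, h1, h2]
    refine (hcc_cubic_bound (u 0) (u 1) (ξ 0) (ξ 1) (‖u‖ * ‖ξ‖) (mul_nonneg (norm_nonneg _) (norm_nonneg _))
      (by rw [mul_pow, hu2, hξ2])).trans_eq ?_
    ring

end Summit.AtomisticToContinuum.Crystallization.Theorems.PeriodicWindowsDenseLaminarHull

end
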